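import Summits.ResolutionOfSingularities.ResolutionOfSingularities.Theorems.HomologicalConductorNoZenoCapture
import Summits.ResolutionOfSingularities.ResolutionOfSingularities.Theorems.HomologicalConductorNoZenoIffKernel
import HarnessLib

/-!
# Crux `NoZeno` / `NoZenoR` (stmt-ResolutionOfSingularities-16483 / -19943), line `sandwich-cluster`:
# the ⊆ half of the cluster calculus `stub_basePtsStrictAnti` («no new base point»), abstract form

Route `ResolutionOfSingularities/HomologicalConductor`.  OURS (cell res-hironaka); nothing here is a
statement of the manuscript under review.  Line `sandwich-cluster` (CRUX-PLAN W4.4 v2 §2) measures a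
sandwiched stage `T_m = tower O A m` by its BASE POINTS over the regular `R`:
`basePts R T := {S | R ≤ S ∧ IsRegularLocalRing S ∧ ringKrullDim S = 2 ∧ ¬ T ≤ S ∧ Dominates (ordSet S) T}`,
`Dominates V X := ∀ t ∈ X, t ∈ V ∧ (t⁻¹ ∈ V → t⁻¹ ∈ X)`, `ordSet S` = the order pseudo-valuation ring
of `S`.  Stub S4 `stub_basePtsStrictAnti` asserts `basePts R T_(m+1) ⊂ basePts R T_m` under
(Q_val at `m`): «`ca(T_m)` generates a principal ideal in every regular local `S ⊇ T_m`».

This file proves the INCLUSION half `basePts R T_(m+1) ⊆ basePts R T_m` in ABSTRACT form — with the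
order pseudo-valuation ring replaced by any `V ⊆ K` closed under `+` and `*` that dominates `S`
(`basePt_descends`) — from the landed capture step (`captureOfPrincipal`,
`Theorems/HomologicalConductorNoZenoCapture.lean`).  The literal `basePts` form follows by taking for
`V` the subsemiring with carrier `ordSet S` (closure of `ordSet S` under `+`, `*` for REGULAR `S` is the
order-valuation property `ord(fg) = ord f + ord g`, `Literature/…/RegularLocalOrderValuation.lean`;
domination of `S` by `ordSet S` is `inv_mem_of_inv_mem_ordSet` + `exists_ordSet_rep_of_mem` below).

* `mem_of_isIntegral_of_isRegularLocalRing` — a regular local `S ≤ K` with `Frac S = K` is integrally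
  closed in `K` (tree: `isIntegrallyClosed_of_isRegularLocalRing`, Matsumura 19.4).
* `captureOfPrincipal_of_isRegularLocalRing` — CAPTURE for regular local `S`.
* `valuationSubring_dominates_tower` — `O` dominates every stage: `T_m ⊆ O` and `T_m` is
  `O`-LOCAL (`t ∈ T_m`, `t⁻¹ ∈ O ⇒ t⁻¹ ∈ T_m`).
* `dominates_tower_of_dominates_tower_succ` — if `V` dominates `T_(m+1)` then `V` dominates `T_m`
  (`T_m ≤ T_(m+1) ⊆ O` and `O`-locality), for an arbitrary set `V`.
* `exists_ordSet_rep_of_mem` — `S ⊆ ordSet S` (unfolded): `x = x * 1⁻¹`, `x, 1 ∈ J⁰`, `1 ∉ J¹`.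
* `basePt_descends` — **the ⊆ half of S4, abstract form**: under (Q_val at `m`), a regular
  2-dimensional local `S ⊇ R` (`Frac R = K`), dominated by `V`, with `¬ T_(m+1) ≤ S` and `V`
  dominating `T_(m+1)`, has `¬ T_m ≤ S` and `V` dominating `T_m`.

References: J. Lipman, Publ. IHÉS 36 (1969) §18 [`Lipman1969`]; M. Spivakovsky, Ann. of Math. 131
(1990) §II [`Spivakovsky1990`]; H. Matsumura, Commutative Ring Theory (1987) Thm 19.4 [`Matsumura1987`].
-/

noncomputable section

-- single-problem summit: the doubled namespace component `ResolutionOfSingularities` is forced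
set_option linter.dupNamespace false

namespace Summit.ResolutionOfSingularities.ResolutionOfSingularities.Theorems.NoZeno.SandwichCluster

open Summit.ResolutionOfSingularities.ResolutionOfSingularities.Theses.HomologicalConductor
open Summit.ResolutionOfSingularities.ResolutionOfSingularities.Theorems.NoZeno.Birth
open Literature.AlgebraicGeometry.Resolution

variable {k K : Type} [Field k] [Field K] [Algebra k K]

/-! ## Regular local subalgebras are integrally closed in `K` -/

/-- A regular local `k`-subalgebra `S` of `K` with `Frac S = K` is integrally closed in `K`.
[cite: Matsumura1987, Thm. 19.4] -/
theorem mem_of_isIntegral_of_isRegularLocalRing (S : Subalgebra k K) [IsFractionRing ↥S K]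
    (hS : IsRegularLocalRing ↥S) (y : K) (hy : IsIntegral ↥S y) : y ∈ S := by
  haveI := hS
  haveI : IsIntegrallyClosed ↥S := isIntegrallyClosed_of_isRegularLocalRing ↥S
  obtain ⟨s, hs⟩ := IsIntegrallyClosed.algebraMap_eq_of_integral hy
  rw [← hs]
  exact s.2

/-- **CAPTURE for a regular local ring.** If `T ≤ S` with `S` regular local, `Frac S = K`, the ideal
`ca T · S` principal, `V ⊆ K` closed under `+`, `*` dominating `S`, and the next stage
`loc O (nrm (chart O T))` contained in `V`, then the next stage lies in `S`.
[cite: Lipman1969, §18; Spivakovsky1990, §II] -/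
theorem captureOfPrincipal_of_isRegularLocalRing {σ : Type*} [SetLike σ K] [SubsemiringClass σ K]
    (O : ValuationSubring K) (V : σ) (T S : Subalgebra k K) (hTS : T ≤ S) [IsFractionRing ↥S K]
    (hS : IsRegularLocalRing ↥S) (hca : (Ideal.span {s : ↥S | (s : K) ∈ ca T}).IsPrincipal)
    (hVS : ∀ t : K, t ∈ S → t ∈ (V : Set K) ∧ (t⁻¹ ∈ (V : Set K) → t⁻¹ ∈ S))
    (hVT : ∀ t : K, t ∈ loc O (nrm (chart O T)) → t ∈ (V : Set K)) :
    loc O (nrm (chart O T)) ≤ S :=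
  captureOfPrincipal O V T S hTS (mem_of_isIntegral_of_isRegularLocalRing S hS) hca hVS hVT

/-! ## Stages are `O`-local; domination descends one stage -/

/-- **`O` dominates every stage of the tower** (the line's `Dominates (O : Set K) (tower O A m)`,
unfolded): `T_m ⊆ O`, and an element of `T_m = tower O A m` whose inverse lies in `O` is inverted in
`T_m` (`T_m = loc O B` with `B ⊆ O`, and `loc O B` inverts its `O`-units). [folklore] -/
theorem valuationSubring_dominates_tower (O : ValuationSubring K) (A : Subalgebra k K)
    (hk : ∀ c : k, algebraMap k K c ∈ O) (hAO : A.toSubring ≤ O.toSubring) (m : ℕ) :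
    ∀ t : K, t ∈ tower O A m → t ∈ O ∧ (t⁻¹ ∈ O → t⁻¹ ∈ tower O A m) := by
  intro t ht
  refine ⟨mem_valuationSubring_of_mem_tower O hk hAO m t ht, fun htO => ?_⟩
  obtain ⟨B, hBO, hTB⟩ := exists_tower_eq_loc O A hk hAO m
  rw [hTB] at ht ⊢
  by_cases ht0 : t = 0
  · rw [ht0, inv_zero]; exact Subalgebra.zero_mem _
  rw [loc_eq_locAt] at ht ⊢
  have htO' : t ∈ O := SyzygyFlattening.locAt_toSubring_le O hk hBO ht
  exact SyzygyFlattening.inv_mem_locAt O B hBO ht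
    (SyzygyFlattening.valuation_eq_one_of_inv_mem O htO' htO ht0)

/-- **Domination descends one stage.** If a set `V ⊆ K` dominates `T_(m+1)` (contains it, and an
element of `T_(m+1)` inverted in `V` is inverted in `T_(m+1)`), then `V` dominates `T_m`: for
`t ∈ T_m ≤ T_(m+1)` with `t⁻¹ ∈ V` one gets `t⁻¹ ∈ T_(m+1) ⊆ O`, hence `t⁻¹ ∈ T_m` by `O`-locality.
[folklore] -/
theorem dominates_tower_of_dominates_tower_succ (O : ValuationSubring K) (A : Subalgebra k K)
    (hk : ∀ c : k, algebraMap k K c ∈ O) (hAO : A.toSubring ≤ O.toSubring) (m : ℕ) (V : Set K)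
    (h : ∀ t : K, t ∈ tower O A (m + 1) → t ∈ V ∧ (t⁻¹ ∈ V → t⁻¹ ∈ tower O A (m + 1))) :
    ∀ t : K, t ∈ tower O A m → t ∈ V ∧ (t⁻¹ ∈ V → t⁻¹ ∈ tower O A m) := by
  intro t ht
  -- `T_m ≤ chart O T_m ≤ T_(m+1)`
  have ht' : t ∈ tower O A (m + 1) := by
    rw [tower_succ]
    exact chart_le_loc_nrm_chart O _ (Algebra.subset_adjoin (Or.inl ht))
  refine ⟨(h t ht').1, fun hinv => (valuationSubring_dominates_tower O A hk hAO m t ht).2 ?_⟩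
  exact (valuationSubring_dominates_tower O A hk hAO (m + 1) _ ((h t ht').2 hinv)).1

/-! ## `S ⊆ ordSet S` -/

/-- **`S ⊆ ordSet S`** (unfolded): every `x ∈ S` is `x * 1⁻¹` with `x, 1 ∈ J⁰ = S` and `1 ∉ J¹ = J`,
`J` the Jacobson radical of `S` (a proper ideal: `S ≤ K` is non-trivial).  Together with
`inv_mem_of_inv_mem_ordSet` (`…Capture.lean`): `ordSet S` dominates every LOCAL `S`. [folklore] -/
theorem exists_ordSet_rep_of_mem (S : Subalgebra k K) {x : K} (hx : x ∈ S) :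
    ∃ n : ℕ, ∃ a b : ↥S, a ∈ ((⊥ : Ideal ↥S).jacobson) ^ n ∧
      b ∈ ((⊥ : Ideal ↥S).jacobson) ^ n ∧ b ∉ ((⊥ : Ideal ↥S).jacobson) ^ (n + 1) ∧
      x = (a : K) * ((b : K))⁻¹ := by
  refine ⟨0, ⟨x, hx⟩, 1, ?_, ?_, ?_, ?_⟩
  · rw [pow_zero, Ideal.one_eq_top]; exact Submodule.mem_top
  · rw [pow_zero, Ideal.one_eq_top]; exact Submodule.mem_top
  · rw [zero_add, pow_one]
    intro h1
    have htop : (⊥ : Ideal ↥S).jacobson = ⊤ := (Ideal.eq_top_iff_one _).mpr h1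
    exact bot_ne_top (Ideal.jacobson_eq_top_iff.mp htop)
  · simp

/-! ## The ⊆ half of S4, abstract form -/

/-- **No new base point (the ⊆ half of `stub_basePtsStrictAnti`, abstract form).**  Fix a stage
index `m` and assume (Q_val at `m`): the cohomology annihilator `ca(T_m)` generates a principal ideal
in every regular local `k`-subalgebra `S' ⊇ T_m` of `K`.  Let `S ⊇ R` be regular local of
dimension `2` (`Frac R = K`), dominated by a set `V ⊆ K` closed under `+` and `*`.  If `S` is a
«base point of `T_(m+1)` seen through `V`» (`¬ T_(m+1) ≤ S` and `V` dominates `T_(m+1)`), then `S`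
is a base point of `T_m` seen through `V` (`¬ T_m ≤ S` — by CAPTURE — and `V` dominates `T_m`).
With `V` = the order valuation ring `ordSet S` this is literally
`S ∈ basePts R T_(m+1) → S ∈ basePts R T_m`. [cite: Lipman1969, §18; Spivakovsky1990, §II] -/
theorem basePt_descends (O : ValuationSubring K) (A : Subalgebra k K)
    (hk : ∀ c : k, algebraMap k K c ∈ O) (hAO : A.toSubring ≤ O.toSubring) (m : ℕ)
    {σ : Type*} [SetLike σ K] [SubsemiringClass σ K] (V : σ) (R S : Subalgebra k K)
    (hRfr : IsFractionRing ↥R K)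
    (hQ : ∀ S' : Subalgebra k K, tower O A m ≤ S' → IsRegularLocalRing ↥S' →
      (Ideal.span {s : ↥S' | (s : K) ∈ ca (tower O A m)}).IsPrincipal)
    (hVS : ∀ t : K, t ∈ S → t ∈ (V : Set K) ∧ (t⁻¹ ∈ (V : Set K) → t⁻¹ ∈ S))
    (h : R ≤ S ∧ IsRegularLocalRing ↥S ∧ ringKrullDim ↥S = 2 ∧ ¬ tower O A (m + 1) ≤ S ∧
      ∀ t : K, t ∈ tower O A (m + 1) →
        t ∈ (V : Set K) ∧ (t⁻¹ ∈ (V : Set K) → t⁻¹ ∈ tower O A (m + 1))) :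
    R ≤ S ∧ IsRegularLocalRing ↥S ∧ ringKrullDim ↥S = 2 ∧ ¬ tower O A m ≤ S ∧
      ∀ t : K, t ∈ tower O A m → t ∈ (V : Set K) ∧ (t⁻¹ ∈ (V : Set K) → t⁻¹ ∈ tower O A m) := by
  obtain ⟨hRS, hreg, hdim, hnot, hdom⟩ := h
  haveI := hRfr
  haveI : IsFractionRing ↥S K := isFractionRing_subalgebra_of_le R S hRS
  refine ⟨hRS, hreg, hdim, fun hle => hnot ?_,
    dominates_tower_of_dominates_tower_succ O A hk hAO m (V : Set K) hdom⟩
  rw [tower_succ]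
  refine captureOfPrincipal_of_isRegularLocalRing O V (tower O A m) S hle hreg (hQ S hle hreg) hVS ?_
  intro t ht
  exact (hdom t (by rw [tower_succ]; exact ht)).1

end Summit.ResolutionOfSingularities.ResolutionOfSingularities.Theorems.NoZeno.SandwichCluster

end
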